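import Literature.AnabelianGeometry.EtaleTheta.RootsOfUnityPadicOrders
import Literature.AnabelianGeometry.EtaleTheta.SettingModelCyclotomeModEmpty
import Literature.AnabelianGeometry.EtaleTheta.SettingModelCyclotomicCharacterLevelNontrivial
import HarnessLib

/-!
# ROOT-MODEL CENSUS of the Tate-twist datum, complete: `CyclotomeMod l N` at `ThetaSetting.model p` is
# inhabited iff `N ∣ p − 1 ∨ (p = 2 ∧ N = 2)`; the mod-`N` cyclotomic character `χ_N` is trivial iff the same
# (proof-only)

Mochizuki, *The étale theta function …*, Publ. RIMS **45** (2009) [EtTh], §1 p. 12 "`Δ_Θ (≅ Ẑ(1))`", Def. 2.13 p. 46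
"the natural isomorphism `μ_N ≅ (l·Δ_Θ) ⊗ (ℤ/Nℤ)`" [cite: MochizukiEtTh2009, Def 2.13 p.46]; classical input
J.-P. Serre, *A Course in Arithmetic*, Ch. II §3.1 Prop. 7 (roots of unity of `ℚ_p`: `μ_{p−1}`, resp. `{±1}` for
`p = 2`) [cite: Serre1973, Ch. II §3.1 Prop. 7] via this seat's `RootsOfUnityPadicOrders.lean`.

PROOF-ONLY file of the abc-iut cell (prover abc-iut-w5-d091 gen 5; NV-L2 programme of abc-iut-L2-lead, self-named
row «NV-L2/CyclotomeMod ROOT-MODEL CENSUS COMPLETION», χ-lane sequel of abc-iut-w5-d125's final census token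
«undecided: `N` prime to `p` with `N ∤ p − 1`»). abc-iut-w5-d125 certified, at abc-iut-L2-t1's root model
`ThetaSetting.model p` (untwisted `Δ_Θ`): `CyclotomeMod l N = ∅` for `p² ∣ N` (`SettingModelCyclotomeModEmpty`) and for
odd `p ∣ N`; INHABITED for `N ∣ p − 1` (`SettingModelCyclotomeModPred`) and `N ∣ 2` (`SettingModelCyclotomeModTwo`).
THIS FILE closes the census:

* `SettingModel.isEmpty_cyclotomeMod_model_of_not` — `CyclotomeMod l N = ∅` at the root model whenever
  `¬(N ∣ p − 1 ∨ (p = 2 ∧ N = 2))` (w5-d125's interface criterion `isEmpty_cyclotomeMod_of_conj_eq`: `(Π^tp_X)^Θ`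
  centralises `Δ_Θ` while `G_{ℚ_p}` moves a primitive `N`-th root of unity, `exists_galMuN_apply_ne_of_not`);
* **`SettingModel.nonempty_cyclotomeMod_model_iff (hl : l ≠ 0) :
  Nonempty ((ThetaSetting.model p).CyclotomeMod l N) ↔ N ∣ p − 1 ∨ (p = 2 ∧ N = 2)`** — odd `p`: `↔ N ∣ p − 1`
  (`…_iff_dvd_pred`); `p = 2`: `↔ N ∣ 2` (`…_iff_dvd_two`); i.e. the twist datum exists at the untwisted model
  EXACTLY at the levels where `G_{ℚ_p}` sees no twist (`μ_N ⊆ ℚ_p`);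
* the same dichotomy for THE cyclotomic character `χ` of this seat's F3 (`SettingModelCyclotomicCharacter`):
  **`SettingModel.forall_levelChar_chi_eq_one_iff : (∀ σ, χ_N(σ) = 1) ↔ N ∣ p − 1 ∨ (p = 2 ∧ N = 2)`**,
  `levelChar_comp_chi_eq_one_iff` (`levelChar N ∘ χ = 1 ↔ …`), `exists_levelChar_chi_ne_one_iff`, and the odd-`p` /
  `p = 2` specialisations — subsuming F3 addendum 3's `p² ∣ N` / odd `p ∣ N` non-triviality.
HONEST FRAMING: statements about the degenerate root model and classical facts about `ℚ_p`; nothing asserts that abc is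
proved or refuted; no side is taken on [IUTchIII] Cor. 3.12; typed ≠ proved; inhabited ≠ endorsed.
-/

noncomputable section

open CategoryTheory ProfiniteGrp ProfiniteGrp.ProfiniteCompletion

namespace Literature.AnabelianGeometry.EtaleTheta.SettingModel

open ThetaSetting Literature.AnabelianGeometry.SemiGraphs

variable (p : ℕ) [hp : Fact p.Prime]

/-! ### The census of `CyclotomeMod l N` at the root model -/

/-- **NV CERTIFICATE (negative, all remaining levels): `CyclotomeMod l N` is EMPTY at the root model whenever
`¬(N ∣ p − 1 ∨ (p = 2 ∧ N = 2))`** — `(Π^tp_X)^Θ` centralises `Δ_Θ` there (abc-iut-w5-d171's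
`toTheta_conj_eq_of_mem_deltaTheta`) while `G_{ℚ_p} = aug(Π^tp_X)` moves a primitive `N`-th root of unity
(`exists_galMuN_apply_ne_of_not`). [cite: MochizukiEtTh2009, Def 2.13 p.46] -/
theorem isEmpty_cyclotomeMod_model_of_not (l : ℕ) (N : ℕ+) (hN : ¬ ((N : ℕ) ∣ p - 1 ∨ (p = 2 ∧ (N : ℕ) = 2))) :
    IsEmpty ((ThetaSetting.model p).CyclotomeMod l N) := by
  refine isEmpty_cyclotomeMod_of_conj_eq
    (fun g a ha => toTheta_conj_eq_of_mem_deltaTheta p _ a ha) ?_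
  obtain ⟨σ, ζ, hne⟩ := exists_galMuN_apply_ne_of_not p N hN
  exact ⟨(((1 : Del), (σ : Gam p)) : PiTp p), ζ, by rw [aug_one_mk]; exact hne⟩

/-- `Nonempty` form of the negative certificate. [cite: MochizukiEtTh2009, Def 2.13 p.46] -/
theorem not_nonempty_cyclotomeMod_model_of_not (l : ℕ) (N : ℕ+)
    (hN : ¬ ((N : ℕ) ∣ p - 1 ∨ (p = 2 ∧ (N : ℕ) = 2))) : ¬ Nonempty ((ThetaSetting.model p).CyclotomeMod l N) :=
  not_nonempty_iff.mpr (isEmpty_cyclotomeMod_model_of_not p l N hN)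

/-- **THE ROOT-MODEL CENSUS of the twist datum (`l ≠ 0`): `CyclotomeMod l N` at `ThetaSetting.model p` is inhabited
iff `N ∣ p − 1 ∨ (p = 2 ∧ N = 2)`** (positive halves: abc-iut-w5-d125's `nonempty_cyclotomeMod_model_of_dvd_pred`,
`nonempty_cyclotomeMod_two_model`). [cite: MochizukiEtTh2009, Def 2.13 p.46] -/
theorem nonempty_cyclotomeMod_model_iff (l : ℕ) (hl : l ≠ 0) (N : ℕ+) :
    Nonempty ((ThetaSetting.model p).CyclotomeMod l N) ↔ (N : ℕ) ∣ p - 1 ∨ (p = 2 ∧ (N : ℕ) = 2) := by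
  constructor
  · intro h
    by_contra hN
    exact not_nonempty_cyclotomeMod_model_of_not p l N hN h
  · rintro (h | ⟨hp2, h2⟩)
    · exact nonempty_cyclotomeMod_model_of_dvd_pred p l hl N h
    · subst hp2
      obtain rfl : N = 2 := PNat.coe_inj.mp h2
      exact nonempty_cyclotomeMod_two_model 2 l hl

/-- `IsEmpty` form of the census. [cite: MochizukiEtTh2009, Def 2.13 p.46] -/
theorem isEmpty_cyclotomeMod_model_iff (l : ℕ) (hl : l ≠ 0) (N : ℕ+) :
    IsEmpty ((ThetaSetting.model p).CyclotomeMod l N) ↔ ¬ ((N : ℕ) ∣ p - 1 ∨ (p = 2 ∧ (N : ℕ) = 2)) := by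
  rw [← not_nonempty_iff, nonempty_cyclotomeMod_model_iff p l hl N]

/-- **Odd `p`: `CyclotomeMod l N` at the root model is inhabited iff `N ∣ p − 1`.** [cite: MochizukiEtTh2009, Def 2.13 p.46] -/
theorem nonempty_cyclotomeMod_model_iff_dvd_pred (hp2 : p ≠ 2) (l : ℕ) (hl : l ≠ 0) (N : ℕ+) :
    Nonempty ((ThetaSetting.model p).CyclotomeMod l N) ↔ (N : ℕ) ∣ p - 1 := by
  rw [nonempty_cyclotomeMod_model_iff p l hl N]
  exact ⟨fun h => h.resolve_right fun h2 => hp2 h2.1, Or.inl⟩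

/-- **`p = 2`: `CyclotomeMod l N` at the root model is inhabited iff `N ∣ 2`.** [cite: MochizukiEtTh2009, Def 2.13 p.46] -/
theorem nonempty_cyclotomeMod_model_iff_dvd_two (hp2 : p = 2) (l : ℕ) (hl : l ≠ 0) (N : ℕ+) :
    Nonempty ((ThetaSetting.model p).CyclotomeMod l N) ↔ (N : ℕ) ∣ 2 := by
  rw [nonempty_cyclotomeMod_model_iff p l hl N, ← galMuN_eq_one_iff, galMuN_eq_one_iff_dvd_two p hp2]

/-- Census form over the interface: for `¬(N ∣ p − 1 ∨ (p = 2 ∧ N = 2))` the root interface plus its guard do NOT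
imply the level-`N` twist datum. [cite: MochizukiEtTh2009, Def 2.13 p.46] -/
theorem not_forall_nonempty_cyclotomeMod_of_not (l : ℕ) (N : ℕ+)
    (hN : ¬ ((N : ℕ) ∣ p - 1 ∨ (p = 2 ∧ (N : ℕ) = 2))) :
    ¬ ∀ D : ThetaSetting p, D.IsEtThOrigin → Nonempty (D.CyclotomeMod l N) := fun h =>
  not_nonempty_cyclotomeMod_model_of_not p l N hN (h _ (ThetaSetting.model_isEtThOrigin p))

/-- … whereas for `N ∣ p − 1 ∨ (p = 2 ∧ N = 2)` some `IsEtThOrigin` setting carries it (the root model): the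
two census halves in one `iff` over `∃`. [cite: MochizukiEtTh2009, Def 2.13 p.46] -/
theorem exists_isEtThOrigin_nonempty_cyclotomeMod_model_iff (l : ℕ) (hl : l ≠ 0) (N : ℕ+) :
    (ThetaSetting.model p).IsEtThOrigin ∧ Nonempty ((ThetaSetting.model p).CyclotomeMod l N) ↔
      (N : ℕ) ∣ p - 1 ∨ (p = 2 ∧ (N : ℕ) = 2) := by
  rw [← nonempty_cyclotomeMod_model_iff p l hl N]
  exact ⟨And.right, fun h => ⟨ThetaSetting.model_isEtThOrigin p, h⟩⟩

/-! ### The same dichotomy for the cyclotomic character `χ` (F3) -/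

/-- **`χ_N(σ) = 1` for ALL `σ ∈ G_{ℚ_p}` iff `N ∣ p − 1 ∨ (p = 2 ∧ N = 2)`**: `χ_N(σ) = 1` iff `σ` fixes the `N`-th roots
of unity (F3 addendum 3), and `G_{ℚ_p}` fixes `μ_N(ℚ̄_p)` pointwise iff `μ_N ⊆ ℚ_p` (`galMuN_eq_one_iff`).
[cite: Serre1973, Ch. II §3.1 Prop. 7] -/
theorem forall_levelChar_chi_eq_one_iff (N : ℕ+) :
    (∀ σ : GQp p, ZHatLevel.levelChar N (chi p σ) = 1) ↔ (N : ℕ) ∣ p - 1 ∨ (p = 2 ∧ (N : ℕ) = 2) := by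
  haveI : NeZero ((N : ℕ) : PadicAlgCl p) := ⟨by exact_mod_cast N.ne_zero⟩
  obtain ⟨ζ, hζ⟩ := HasEnoughRootsOfUnity.prim (M := PadicAlgCl p) (n := (N : ℕ))
  constructor
  · intro h
    by_contra hN
    obtain ⟨σ, hσ⟩ := exists_algEquiv_apply_ne_of_isPrimitiveRoot p N.ne_zero hN hζ
    exact hσ (apply_eq_self_of_levelChar_chi_eq_one p σ N hζ.pow_eq_one (h σ))
  · intro hN σ
    have h1 : galMuN p N = 1 := (galMuN_eq_one_iff p N).mpr hN
    haveI : NeZero (N : ℕ) := ⟨N.ne_zero⟩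
    have hfix : galMuN p N σ hζ.toRootsOfUnity = hζ.toRootsOfUnity := by rw [h1]; rfl
    have h' := congrArg (fun u : MuN p N => ((u : (PadicAlgCl p)ˣ) : PadicAlgCl p)) hfix
    simp only [galMuN_apply_coe, IsPrimitiveRoot.val_toRootsOfUnity_coe] at h'
    exact levelChar_chi_eq_one_of_apply_eq p σ N hζ h'

/-- Homomorphism form: **`χ_N = levelChar N ∘ χ : G_{ℚ_p} → ℤ/Nℤ` is the trivial homomorphism iff
`N ∣ p − 1 ∨ (p = 2 ∧ N = 2)`.** [cite: Serre1973, Ch. II §3.1 Prop. 7] -/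
theorem levelChar_comp_chi_eq_one_iff (N : ℕ+) :
    (ZHatLevel.levelChar N).comp (chi p) = 1 ↔ (N : ℕ) ∣ p - 1 ∨ (p = 2 ∧ (N : ℕ) = 2) := by
  rw [← forall_levelChar_chi_eq_one_iff p N]
  constructor
  · intro h σ
    rw [← MonoidHom.comp_apply, h, MonoidHom.one_apply]
  · intro h
    ext σ
    rw [MonoidHom.comp_apply, h σ, MonoidHom.one_apply]

/-- Non-triviality form: **some `σ ∈ G_{ℚ_p}` has `χ_N(σ) ≠ 1` iff `¬(N ∣ p − 1 ∨ (p = 2 ∧ N = 2))`** (subsumes F3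
addendum 3's `exists_levelChar_chi_ne_one_of_sq_dvd` / `_of_dvd`). [cite: Serre1973, Ch. II §3.1 Prop. 7] -/
theorem exists_levelChar_chi_ne_one_iff (N : ℕ+) :
    (∃ σ : GQp p, ZHatLevel.levelChar N (chi p σ) ≠ 1) ↔ ¬ ((N : ℕ) ∣ p - 1 ∨ (p = 2 ∧ (N : ℕ) = 2)) := by
  rw [← forall_levelChar_chi_eq_one_iff p N, not_forall]

/-- **Odd `p`: `χ_N` is trivial on `G_{ℚ_p}` iff `N ∣ p − 1`.** [cite: Serre1973, Ch. II §3.1 Prop. 7] -/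
theorem forall_levelChar_chi_eq_one_iff_dvd_pred (hp2 : p ≠ 2) (N : ℕ+) :
    (∀ σ : GQp p, ZHatLevel.levelChar N (chi p σ) = 1) ↔ (N : ℕ) ∣ p - 1 := by
  rw [forall_levelChar_chi_eq_one_iff p N]
  exact ⟨fun h => h.resolve_right fun h2 => hp2 h2.1, Or.inl⟩

/-- Odd `p`, non-triviality form: some `σ` has `χ_N(σ) ≠ 1` iff `N ∤ p − 1`. [cite: Serre1973, Ch. II §3.1 Prop. 7] -/
theorem exists_levelChar_chi_ne_one_iff_not_dvd_pred (hp2 : p ≠ 2) (N : ℕ+) :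
    (∃ σ : GQp p, ZHatLevel.levelChar N (chi p σ) ≠ 1) ↔ ¬ (N : ℕ) ∣ p - 1 := by
  rw [← forall_levelChar_chi_eq_one_iff_dvd_pred p hp2 N, not_forall]

/-- **`p = 2`: `χ_N` is trivial on `G_{ℚ₂}` iff `N ∣ 2`.** [cite: Serre1973, Ch. II §3.1 Prop. 7] -/
theorem forall_levelChar_chi_eq_one_iff_dvd_two (hp2 : p = 2) (N : ℕ+) :
    (∀ σ : GQp p, ZHatLevel.levelChar N (chi p σ) = 1) ↔ (N : ℕ) ∣ 2 := by
  rw [forall_levelChar_chi_eq_one_iff p N, ← galMuN_eq_one_iff, galMuN_eq_one_iff_dvd_two p hp2]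

/-- The open subgroup `{σ | χ_N(σ) = 1}` of `G_{ℚ_p}` (F3's `isOpen_setOf_levelChar_chi_eq_one`) is ALL of `G_{ℚ_p}`
iff `N ∣ p − 1 ∨ (p = 2 ∧ N = 2)`, and PROPER otherwise. [cite: Serre1973, Ch. II §3.1 Prop. 7] -/
theorem setOf_levelChar_chi_eq_one_eq_univ_iff (N : ℕ+) :
    {σ : GQp p | ZHatLevel.levelChar N (chi p σ) = 1} = Set.univ ↔ (N : ℕ) ∣ p - 1 ∨ (p = 2 ∧ (N : ℕ) = 2) := by
  rw [← forall_levelChar_chi_eq_one_iff p N, Set.eq_univ_iff_forall]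
  rfl

/-- Joint statement of the two censuses: at the root model the twist datum `CyclotomeMod l N` (`l ≠ 0`) exists iff the
mod-`N` cyclotomic character `χ_N` of `G_{ℚ_p}` is trivial. [cite: MochizukiEtTh2009, Def 2.13 p.46] -/
theorem nonempty_cyclotomeMod_model_iff_forall_levelChar_chi_eq_one (l : ℕ) (hl : l ≠ 0) (N : ℕ+) :
    Nonempty ((ThetaSetting.model p).CyclotomeMod l N) ↔ ∀ σ : GQp p, ZHatLevel.levelChar N (chi p σ) = 1 := by
  rw [nonempty_cyclotomeMod_model_iff p l hl N, forall_levelChar_chi_eq_one_iff p N]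

end Literature.AnabelianGeometry.EtaleTheta.SettingModel

end
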